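import Summits.KontsevichZagierPeriods.Zeta5Search.WedgeDictionaryThreeTerm
import HarnessLib

/-!
# Four-term contiguity with explicit coefficients, the 3-of-4 step, and the BRIDGE relation family (statements)

HONEST FRAMING: systematic search; no irrationality claim unless certified.
OUR work (Summit side; cell `pub-zeta5`, planner gen-1 g15, 2026-08-21; memo `pub-zeta5-gen-1/D2-CONNECTION-g15.md` §11).

`WedgeDictionaryThreeTerm` gives the three-term transfer lemmas and the STAR / PENCIL families.  The mixed-parity
**BRIDGE** cluster of g15 (memo §11.2) is the four-point cluster
`{a, a − slotDown 7, a + halfUp457, a + dsUp}` = `{c, c+s₇, H₄₅₇c, DS c}` in dual coordinates (`c = b(a)`, `N = c₀`;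
`H₄₅₇c = (N+1; c + 1_{{4,5,7}})` lies on the odd-shifted level `N+1`, `DS c = (N+2; c+1)`), whose dictionary relation
has the closed form (exact interpolation, validated; `code/gen1/g15/bridge_interp.py`)
`d_c·v(c) + d₇·v(c+s₇) + d_X·v(H₄₅₇c) + d_DS·v(DS c) = 0`,
`d_c = (N+1−c₇)(2N−c₁−c₂−c₃−c₆−c₇)`, `d₇ = −(N−c₃−c₇)(N−c₆−c₇)`, `d_X = (N+1−c₇)(N+1−c₁−c₆)`, `d_DS = (c₁+1)(c₆+1)`,
and whose cellular counterpart has a ONE-TERM creative-telescoping certificate (memo §11.2(ii); the polynomial core is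
`WedgeDictionaryBridgeCertificate.bridge_certificate_identity`).  Its point: exactly ONE member lies above level `N+1`
and its coefficient `(c₁+1)(c₆+1)` is POSITIVE on the region of `explicitPQ` — so it propagates `explicitPQ` upward
level by level through both parities with no non-vanishing side condition (memo §11.3, "architecture v3").

This file PROVES the transfer lemmas for arbitrary four-term relations (`fourTerm_of_at`, the 3-of-4 step
`at_of_fourTerm`), the move lemma `bOfA_add_halfUp457`, the positivity `bridgeApex_pos`, and the BRIDGE induction step
`at_bridge` from the two named statements; it RECORDS `DictBridge` (dictionary side; an identity among `coeffU/W/V`,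
verified exactly at the interpolation and validation points, NOT proved here) and `CellBridge` (cellular side; INTERNALLY
MINTED conjecture, a consequence of `explicitPQ` — `cellBridge_of_explicitPQ`).  What this file is NOT: a proof of either
family; nothing analytic; nothing about irrationality.
-/

noncomputable section

open Finset

namespace Summit.KontsevichZagierPeriods.Zeta5Search.WedgeDictionary

open Summit.KontsevichZagierPeriods.Zeta5Search.DualSeries
open Literature.NumberTheory.Irrationality.BrownZudilin2022 (vwpDual bOfA Converges cellularIntegral QOf)
open Literature.NumberTheory.Transcendental (zetaValue)

/-! ## 1. Four-term relations and the 3-of-4 step -/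

/-- A four-term linear relation among cellular integrals with rational coefficients. -/
def FourTermRel (α β γ δ : ℚ) (a₀ a₁ a₂ a₃ : Fin 8 → ℤ) : Prop :=
  (α : ℝ) * cellularIntegral a₀ + (β : ℝ) * cellularIntegral a₁ + (γ : ℝ) * cellularIntegral a₂ +
    (δ : ℝ) * cellularIntegral a₃ = 0

/-- The same relation for the dictionary vectors `(Q, P̂_d, P_d)` at the four points (partner indices `j₀..j₃`),
componentwise in `ℚ`. -/
def DictFourTerm (α β γ δ : ℚ) (a₀ a₁ a₂ a₃ : Fin 8 → ℤ) (j₀ j₁ j₂ j₃ : ℕ) : Prop :=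
  α * (QOf a₀ : ℚ) + β * (QOf a₁ : ℚ) + γ * (QOf a₂ : ℚ) + δ * (QOf a₃ : ℚ) = 0 ∧
    α * dictPhat a₀ j₀ + β * dictPhat a₁ j₁ + γ * dictPhat a₂ j₂ + δ * dictPhat a₃ j₃ = 0 ∧
      α * dictP a₀ j₀ + β * dictP a₁ j₁ + γ * dictP a₂ j₂ + δ * dictP a₃ j₃ = 0

/-- `explicitPQ` at the four points and the dictionary relation give the relation among the integrals. -/
theorem fourTerm_of_at {α β γ δ : ℚ} {a₀ a₁ a₂ a₃ : Fin 8 → ℤ} {j₀ j₁ j₂ j₃ : ℕ}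
    (hd : DictFourTerm α β γ δ a₀ a₁ a₂ a₃ j₀ j₁ j₂ j₃) (h₀ : ExplicitPQAt a₀ j₀) (h₁ : ExplicitPQAt a₁ j₁)
    (h₂ : ExplicitPQAt a₂ j₂) (h₃ : ExplicitPQAt a₃ j₃) : FourTermRel α β γ δ a₀ a₁ a₂ a₃ := by
  obtain ⟨hq, hph, hp⟩ := hd
  have hq' : (α : ℝ) * (QOf a₀ : ℝ) + (β : ℝ) * (QOf a₁ : ℝ) + (γ : ℝ) * (QOf a₂ : ℝ) + (δ : ℝ) * (QOf a₃ : ℝ) = 0 := by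
    exact_mod_cast hq
  have hph' : (α : ℝ) * (dictPhat a₀ j₀ : ℝ) + (β : ℝ) * (dictPhat a₁ j₁ : ℝ) + (γ : ℝ) * (dictPhat a₂ j₂ : ℝ) +
      (δ : ℝ) * (dictPhat a₃ j₃ : ℝ) = 0 := by
    exact_mod_cast hph
  have hp' : (α : ℝ) * (dictP a₀ j₀ : ℝ) + (β : ℝ) * (dictP a₁ j₁ : ℝ) + (γ : ℝ) * (dictP a₂ j₂ : ℝ) +
      (δ : ℝ) * (dictP a₃ j₃ : ℝ) = 0 := by
    exact_mod_cast hp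
  unfold FourTermRel
  unfold ExplicitPQAt at h₀ h₁ h₂ h₃
  rw [h₀, h₁, h₂, h₃]
  linear_combination (2 * zetaValue 5 + 4 * zetaValue 3 * zetaValue 2) * hq' - 4 * zetaValue 2 * hph' - 2 * hp'

/-- **The 3-of-4 induction step.** A four-term relation among the integrals whose coefficients also kill the four
dictionary vectors, `explicitPQ` at three of the points and `δ ≠ 0` give `explicitPQ` at the fourth point. -/
theorem at_of_fourTerm {α β γ δ : ℚ} {a₀ a₁ a₂ a₃ : Fin 8 → ℤ} {j₀ j₁ j₂ j₃ : ℕ}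
    (hrel : FourTermRel α β γ δ a₀ a₁ a₂ a₃) (hd : DictFourTerm α β γ δ a₀ a₁ a₂ a₃ j₀ j₁ j₂ j₃)
    (h₀ : ExplicitPQAt a₀ j₀) (h₁ : ExplicitPQAt a₁ j₁) (h₂ : ExplicitPQAt a₂ j₂) (hδ : δ ≠ 0) :
    ExplicitPQAt a₃ j₃ := by
  obtain ⟨hq, hph, hp⟩ := hd
  have hq' : (α : ℝ) * (QOf a₀ : ℝ) + (β : ℝ) * (QOf a₁ : ℝ) + (γ : ℝ) * (QOf a₂ : ℝ) + (δ : ℝ) * (QOf a₃ : ℝ) = 0 := by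
    exact_mod_cast hq
  have hph' : (α : ℝ) * (dictPhat a₀ j₀ : ℝ) + (β : ℝ) * (dictPhat a₁ j₁ : ℝ) + (γ : ℝ) * (dictPhat a₂ j₂ : ℝ) +
      (δ : ℝ) * (dictPhat a₃ j₃ : ℝ) = 0 := by
    exact_mod_cast hph
  have hp' : (α : ℝ) * (dictP a₀ j₀ : ℝ) + (β : ℝ) * (dictP a₁ j₁ : ℝ) + (γ : ℝ) * (dictP a₂ j₂ : ℝ) +
      (δ : ℝ) * (dictP a₃ j₃ : ℝ) = 0 := by
    exact_mod_cast hp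
  have hδ' : (δ : ℝ) ≠ 0 := by exact_mod_cast hδ
  unfold FourTermRel at hrel
  unfold ExplicitPQAt at h₀ h₁ h₂ ⊢
  rw [h₀, h₁, h₂] at hrel
  have key : (δ : ℝ) * (cellularIntegral a₃ - ((QOf a₃ : ℝ) * (2 * zetaValue 5 + 4 * zetaValue 3 * zetaValue 2) -
      4 * (dictPhat a₃ j₃ : ℝ) * zetaValue 2 - 2 * (dictP a₃ j₃ : ℝ))) = 0 := by
    linear_combination hrel - (2 * zetaValue 5 + 4 * zetaValue 3 * zetaValue 2) * hq' + 4 * zetaValue 2 * hph' + 2 * hp'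
  rcases mul_eq_zero.1 key with h | h
  · exact absurd h hδ'
  · linarith

/-! ## 2. The half-shift move and the BRIDGE coefficient functions (closed forms of g15, memo §11.2) -/

/-- The half-shift move `H₄₅₇ = e₁ + e₃` in `a`-coordinates (`b ↦ (b₀+1; b + 1_{{4,5,7}})`, to the odd-shifted level). -/
def halfUp457 : Fin 8 → ℤ := ![1, 0, 1, 0, 0, 0, 0, 0]

/-- `b(a + e₁ + e₃)`: the level `b₀` and the slots `4, 5, 7` go up by one, the slots `1, 2, 3, 6` are unchanged. -/
theorem bOfA_add_halfUp457 (a : Fin 8 → ℤ) (n : ℕ) (hn : n ≤ 7) :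
    bOfA (a + halfUp457) n = if n = 0 ∨ n = 4 ∨ n = 5 ∨ n = 7 then bOfA a n + 1 else bOfA a n := by
  interval_cases n <;> simp [bOfA, halfUp457] <;> ring

/-- `b(a − s₇)` raises slot `7` by one (the point `c + s₇` of the memo). -/
theorem bOfA_sub_slotDown7 (a : Fin 8 → ℤ) (n : ℕ) (hn : n ≤ 7) :
    bOfA (a - slotDown 7) n = if n = 7 then bOfA a n + 1 else bOfA a n := by
  interval_cases n <;> simp [bOfA, slotDown]
  ring

/-- BRIDGE coefficient of the base point `c`: `(N+1−c₇)(2N−c₁−c₂−c₃−c₆−c₇)`. -/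
def bridgeBase (c : ℕ → ℤ) : ℤ := (c 0 + 1 - c 7) * (2 * c 0 - c 1 - c 2 - c 3 - c 6 - c 7)

/-- BRIDGE coefficient of the in-level point `c + s₇`: `−(N−c₃−c₇)(N−c₆−c₇)`. -/
def bridgeSlot (c : ℕ → ℤ) : ℤ := -((c 0 - c 3 - c 7) * (c 0 - c 6 - c 7))

/-- BRIDGE coefficient of the half-shifted point `H₄₅₇c`: `(N+1−c₇)(N+1−c₁−c₆)`. -/
def bridgeHalf (c : ℕ → ℤ) : ℤ := (c 0 + 1 - c 7) * (c 0 + 1 - c 1 - c 6)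

/-- BRIDGE coefficient of the apex `DS c`: `(c₁+1)(c₆+1)` — positive on the region of `explicitPQ`. -/
def bridgeApex (c : ℕ → ℤ) : ℤ := (c 1 + 1) * (c 6 + 1)

/-- On the region (`0 ≤ b_i`), the apex coefficient is positive. -/
theorem bridgeApex_pos {a : Fin 8 → ℤ} {j : ℕ} (r : RegionHyp a j) : 0 < bridgeApex (bOfA a) := by
  obtain ⟨_, _, hbox, _, _⟩ := r
  have h1 := (hbox 1 (by simp)).1
  have h6 := (hbox 6 (by simp)).1
  unfold bridgeApex
  positivity

/-! ## 3. The BRIDGE relation family as named statements -/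

/-- **BRIDGE, dictionary side** (an identity among `coeffU/W/V`; found by exact interpolation and validated on fresh
instances, memo §11.2(i); NOT yet proved in Lean — expected from `coeff_update_sub`, `fourTerm_coeff_rel_UWV`,
`coeffU/W/V_dsShift` in the style of `Elimination/PencilConnection.lean`).  At `a` with `c = b(a)`:
`d_c·v(a) + d₇·v(a − s₇) + d_X·v(a + e₁ + e₃) + d_DS·v(a + DS) = 0` for the dictionary vectors, whenever the four points
satisfy the hypotheses of `explicitPQ` with partners `j₀..j₃`. -/
@[conjecture] def DictBridge : Prop :=
  ∀ (a : Fin 8 → ℤ) (j₀ j₁ j₂ j₃ : ℕ),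
    RegionHyp a j₀ → RegionHyp (a - slotDown 7) j₁ → RegionHyp (a + halfUp457) j₂ → RegionHyp (a + dsUp) j₃ →
      DictFourTerm (bridgeBase (bOfA a)) (bridgeSlot (bOfA a)) (bridgeHalf (bOfA a)) (bridgeApex (bOfA a))
        a (a - slotDown 7) (a + halfUp457) (a + dsUp) j₀ j₁ j₂ j₃

/-- **BRIDGE, cellular side (INTERNALLY MINTED; conjecture).** The same four-term relation among the cellular
integrals.  A ONE-TERM creative-telescoping certificate exists uniformly in `a` (memo §11.2(ii); polynomial core
`bridge_certificate_identity`); turning it into this statement needs the contour lemma (H1) inside a common admissible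
chamber (memo §11.8) — not formalised. -/
@[conjecture] def CellBridge : Prop :=
  ∀ (a : Fin 8 → ℤ) (j₀ j₁ j₂ j₃ : ℕ),
    RegionHyp a j₀ → RegionHyp (a - slotDown 7) j₁ → RegionHyp (a + halfUp457) j₂ → RegionHyp (a + dsUp) j₃ →
      FourTermRel (bridgeBase (bOfA a)) (bridgeSlot (bOfA a)) (bridgeHalf (bOfA a)) (bridgeApex (bOfA a))
        a (a - slotDown 7) (a + halfUp457) (a + dsUp)

/-- `explicitPQ` and the dictionary BRIDGE identities imply the cellular BRIDGE relations. -/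
theorem cellBridge_of_explicitPQ (h : explicitPQ) (hd : DictBridge) : CellBridge := by
  rw [explicitPQ_iff_at] at h
  intro a j₀ j₁ j₂ j₃ h₀ h₁ h₂ h₃
  have hd' := hd a j₀ j₁ j₂ j₃ h₀ h₁ h₂ h₃
  have e := fourTerm_of_at hd' (h _ _ h₀) (h _ _ h₁) (h _ _ h₂) (h _ _ h₃)
  unfold FourTermRel at e ⊢
  push_cast at e ⊢
  exact e

/-- **The BRIDGE step of the induction (architecture v3, memo §11.3).** The cellular BRIDGE relation at `a`, the
dictionary BRIDGE identity, and `explicitPQ` at `a`, `a − s₇`, `a + e₁ + e₃` give `explicitPQ` at `a + DS` — with NO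
non-vanishing side condition (the apex coefficient is positive on the region). -/
theorem at_bridge (hc : CellBridge) (hd : DictBridge) {a : Fin 8 → ℤ} {j₀ j₁ j₂ j₃ : ℕ}
    (r₀ : RegionHyp a j₀) (r₁ : RegionHyp (a - slotDown 7) j₁) (r₂ : RegionHyp (a + halfUp457) j₂)
    (r₃ : RegionHyp (a + dsUp) j₃) (h₀ : ExplicitPQAt a j₀) (h₁ : ExplicitPQAt (a - slotDown 7) j₁)
    (h₂ : ExplicitPQAt (a + halfUp457) j₂) : ExplicitPQAt (a + dsUp) j₃ := by
  have hrel := hc a j₀ j₁ j₂ j₃ r₀ r₁ r₂ r₃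
  have hdic := hd a j₀ j₁ j₂ j₃ r₀ r₁ r₂ r₃
  have hne : (bridgeApex (bOfA a) : ℚ) ≠ 0 := by exact_mod_cast (bridgeApex_pos r₀).ne'
  exact at_of_fourTerm hrel hdic h₀ h₁ h₂ hne

/-! ## 4. Sanity checks (values from the memo, §11.2 / `liftsolve_bridge_A.log`) -/

/-- At `a = (4,3,6,3,4,4,7,6)`, `c = b(a) = (12; 5,3,3,5,3,5,0)`: the BRIDGE coefficients are `(104, −63, 39, 36)`
`= 36·(26/9, −7/4, 13/12, 1)`, the engine's exact null vector at that instance. -/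
example : (List.range 8).map (bOfA ![4, 3, 6, 3, 4, 4, 7, 6]) = [12, 5, 3, 3, 5, 3, 5, 0] ∧
    bridgeBase (fun n => [12, 5, 3, 3, 5, 3, 5, 0].getD n 0) = 104 ∧
    bridgeSlot (fun n => [12, 5, 3, 3, 5, 3, 5, 0].getD n 0) = -63 ∧
    bridgeHalf (fun n => [12, 5, 3, 3, 5, 3, 5, 0].getD n 0) = 39 ∧
    bridgeApex (fun n => [12, 5, 3, 3, 5, 3, 5, 0].getD n 0) = 36 := by decide

/-- The moves land where the memo says: `b(a − s₇) = (12; 5,3,3,5,3,5,1)` (`c + s₇`), `b(a + e₁ + e₃) = (13; 5,3,3,6,4,5,1)`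
(`H₄₅₇c`), `b(a + DS) = (14; 6,4,4,6,4,6,1)` (`DS c`). -/
example : (List.range 8).map (bOfA (![4, 3, 6, 3, 4, 4, 7, 6] - slotDown 7)) = [12, 5, 3, 3, 5, 3, 5, 1] ∧
    (List.range 8).map (bOfA (![4, 3, 6, 3, 4, 4, 7, 6] + halfUp457)) = [13, 5, 3, 3, 6, 4, 5, 1] ∧
    (List.range 8).map (bOfA (![4, 3, 6, 3, 4, 4, 7, 6] + dsUp)) = [14, 6, 4, 4, 6, 4, 6, 1] := by decide

end Summit.KontsevichZagierPeriods.Zeta5Search.WedgeDictionary
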